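import Literature.Claims.NS.Permana2026
import Summits.NavierStokesRegularity.NavierStokesRegularity.Theorems.SoloSalvageLucardoOlivaes2026Enstrophy
import Literature.Analysis.FluidPDE.AxisymQuotientRayAverage
import Mathlib.Analysis.ODE.Gronwall
import HarnessLib

/-!
# Solo salvage for claim C119 `Permana2026` (cell `ns-claims`, D-0090): the TRUE bookkeeping steps

Claim C119: skeleton `Literature.Claims.NS.Permana2026` (typist-11 g6, p519971). Two of its steps are
classical bookkeeping, true as typed, and are discharged here (records-grade; the located step of the verdict
is untouched and nothing disputed is asserted):

* `step_6_holds : Step_6` — (22) ⇒ (23) p.6 l.7–13: a function continuous on `[0,T)` whose right derivative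
  is `≤ κ(1 + E)` (`κ ≥ 0`) obeys `E(t) ≤ (E(0)+1)e^{κt} − 1` on `[0,T)` — Grönwall (`Mathlib`'s
  `le_gronwallBound_of_liminf_deriv_right_le` with `δ = E(0)`, `K = ε = κ`).
* `step_9_holds : Step_9` — (26) / p.6 l.43–49: along a solution of the class (`Chae2007.IsLocalSolution`,
  all Sobolev norms bounded on every `[0,T'']`, `T'' < T`), a majorant `F` of `‖ω(·,t)‖_∞` continuous on
  `[0,T]` makes the BKM integral `∫⁻_{(0,T)} ⨆ₓ ‖curl u(t,x)‖ₑ` finite: the Sobolev bounds make every slice's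
  vorticity bounded (`HasBoundedSobolevNormsOn.exists_forall_norm_iteratedFDeriv_le`), so `⨆ₓ‖ω‖ₑ =
  ofReal ‖ω(t)‖_∞ ≤ ofReal F(t) ≤ ofReal (max F)`, and a constant has finite integral over `(0,T)`.

Salvage seat `ns-claims-salvage-p1` g3 (solo lane; no statement item).

WHAT THIS IS NOT: not a claim about NS regularity or blow-up; not a claim about any author beyond the typed
locator.
-/

set_option linter.dupNamespace false

noncomputable section

open Set Filter MeasureTheory Topology
open scoped ENNReal NNReal

namespace Summit.NavierStokesRegularity.NavierStokesRegularity.Theorems.Permana2026Salvage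

open Literature.Analysis.FluidPDE
open Literature.Claims.NS.Chae2007 (IsLocalSolution)

/-- **Step 6 of C119 holds** ((22) ⇒ (23) p.6 l.7–13, abstract Grönwall with right derivatives): if `E` is
continuous on `[0,T)` and has at every `t ∈ [0,T)` a right derivative `≤ κ(1 + E(t))`, `κ ≥ 0`, then
`E(t) ≤ (E(0) + 1)e^{κt} − 1` on `[0,T)`. [cite: Permana2026, (22)–(23) p.6 l.7–13] -/
theorem step_6_holds : Literature.Claims.NS.Permana2026.Step_6 := by
  intro κ T hκ hT E hcont hderiv t ht
  classical
  -- a right-derivative function on `[0,T)`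
  set D : ℝ → ℝ := fun s => if h : s ∈ Ico 0 T then Classical.choose (hderiv s h) else 0 with hDdef
  have hD : ∀ s ∈ Ico 0 T, HasDerivWithinAt E (D s) (Ici s) s ∧ D s ≤ κ * (1 + E s) := by
    intro s hs
    have h := Classical.choose_spec (hderiv s hs)
    simp only [hDdef, dif_pos hs]
    exact h
  have hsub : Ico 0 t ⊆ Ico 0 T := fun s hs => ⟨hs.1, hs.2.trans ht.2⟩
  have key := le_gronwallBound_of_liminf_deriv_right_le (f := E) (f' := D) (δ := E 0) (K := κ) (ε := κ)
    (a := 0) (b := t) (hcont.mono fun s hs => ⟨hs.1, lt_of_le_of_lt hs.2 ht.2⟩)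
    (fun x hx r hr => ((hD x (hsub hx)).1.liminf_right_slope_le hr).mono fun z hz => by
      simpa [slope_def_field, div_eq_inv_mul] using hz)
    le_rfl (fun x hx => by have h := (hD x (hsub hx)).2; linarith) t (right_mem_Icc.2 ht.1)
  rw [sub_zero] at key
  rcases eq_or_ne κ 0 with rfl | hκ0
  · simp only [gronwallBound_K0, zero_mul, add_zero, Real.exp_zero, mul_one] at key ⊢
    linarith
  · simp only [gronwallBound_of_K_ne_0 hκ0, div_self hκ0, one_mul] at key
    linarith

/-- **Step 9 of C119 holds** ((26) and p.6 l.43–49, BKM bookkeeping): along every solution of the class on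
`[0,T)`, a majorant of `‖ω(·,t)‖_∞` continuous on `[0,T]` makes the BKM integral over `(0,T)` finite.
[cite: Permana2026, (26) p.6 l.32–49] -/
theorem step_9_holds : Literature.Claims.NS.Permana2026.Step_9 := by
  intro ν hν T hT v₀ u p hsol F hF hle
  -- `F` is bounded on the compact interval `[0,T]`
  obtain ⟨M, hM⟩ : ∃ M : ℝ, ∀ t ∈ Icc 0 T, F t ≤ M := by
    obtain ⟨M, hM⟩ := (isCompact_Icc.image_of_continuousOn hF).isBounded.bddAbove
    exact ⟨M, fun t ht => hM (mem_image_of_mem F ht)⟩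
  -- at each `t ∈ [0,T)` the vorticity slice is bounded, so the `iSup` is the real sup-norm `≤ F t`
  have hslice : ∀ t ∈ Ico 0 T, (⨆ x, ‖curl (u t) x‖ₑ) ≤ ENNReal.ofReal (F t) := by
    intro t ht
    obtain ⟨B, hB0, hB⟩ := (hsol.sobolev t ht.2).exists_forall_norm_iteratedFDeriv_le
      (fun s hs => hsol.isClassical.contDiff_velocity ⟨hs.1, lt_of_le_of_lt hs.2 ht.2⟩) 1
    set c : ℝ := ‖(curlCLM : (EuclideanSpace ℝ (Fin 3) →L[ℝ] EuclideanSpace ℝ (Fin 3)) →L[ℝ]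
        EuclideanSpace ℝ (Fin 3))‖ with hcdef
    have hc : 0 ≤ c := by positivity
    have hbd : ∀ x, ‖curl (u t) x‖ ≤ c * B := fun x => by
      refine (norm_curl_le (u t) x).trans (mul_le_mul_of_nonneg_left ?_ hc)
      have h := hB t (right_mem_Icc.2 ht.1) x
      rwa [← norm_iteratedFDeriv_zero (𝕜 := ℝ) (f := fderiv ℝ (u t)), norm_iteratedFDeriv_fderiv]
    have hle' : (⨆ x, ‖curl (u t) x‖ₑ) ≤ ENNReal.ofReal (c * B) := by
      refine iSup_le fun x => ?_
      rw [← ofReal_norm]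
      exact ENNReal.ofReal_le_ofReal (hbd x)
    have hne : (⨆ x, ‖curl (u t) x‖ₑ) ≠ ⊤ := ne_top_of_le_ne_top ENNReal.ofReal_ne_top hle'
    have h := hle t ht
    unfold Literature.Claims.NS.Permana2026.supVort at h
    calc (⨆ x, ‖curl (u t) x‖ₑ) = ENNReal.ofReal ((⨆ x, ‖curl (u t) x‖ₑ).toReal) :=
        (ENNReal.ofReal_toReal hne).symm
      _ ≤ ENNReal.ofReal (F t) := ENNReal.ofReal_le_ofReal h
  -- integrate the constant majorant over `(0,T)`
  calc (∫⁻ t in Ioo 0 T, ⨆ x, ‖curl (u t) x‖ₑ)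
      ≤ ∫⁻ _ in Ioo (0:ℝ) T, ENNReal.ofReal M :=
        setLIntegral_mono' measurableSet_Ioo fun t ht =>
          (hslice t ⟨ht.1.le, ht.2⟩).trans (ENNReal.ofReal_le_ofReal (hM t ⟨ht.1.le, ht.2.le⟩))
    _ = ENNReal.ofReal M * volume (Ioo (0:ℝ) T) := setLIntegral_const _ _
    _ < ⊤ := ENNReal.mul_lt_top ENNReal.ofReal_lt_top (by simp [Real.volume_Ioo])

/-! ### Step 4 — the enstrophy identity (20), after the skeleton's rev 2 (Frobenius palinstrophy) -/

section EnstrophyIdentity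

open scoped RealInnerProductSpace
open Literature.Claims.NS (Lindgren2012.stretchPerp Lindgren2012.dissip Lindgren2012.stretchPerp_eq)
open Summit.NavierStokesRegularity.NavierStokesRegularity.Theorems.LucardoOlivaes2026
  (isSolutionOn_of_isLocalSolution)
open Summit.NavierStokesRegularity.NavierStokesRegularity.Theorems.Lindgren2012Salvage
  (lindgren2012_step3_holds integral_stretching_eq_stretch dissip_eq_neg_integral_frobeniusNormSq)

/-- The skeleton's `enstrophy u s = (∫⁻ ‖ω‖ₑ²).toReal` is the Bochner integral `∫ ‖ω‖²` (= the Lindgren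
skeleton's `enstrophy (u s)`) whenever the vorticity slice is continuous. [folklore] -/
private theorem enstrophy_eq_integral {u : ℝ → EuclideanSpace ℝ (Fin 3) → EuclideanSpace ℝ (Fin 3)} {s : ℝ}
    (hc : Continuous (curl (u s))) :
    Literature.Claims.NS.Permana2026.enstrophy u s = ∫ x, ‖curl (u s) x‖ ^ 2 := by
  unfold Literature.Claims.NS.Permana2026.enstrophy
  rw [integral_eq_lintegral_of_nonneg_ae (Eventually.of_forall fun x => sq_nonneg _)
    (hc.norm.pow 2).aestronglyMeasurable]
  congr 1
  refine lintegral_congr fun x => ?_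
  rw [← ofReal_norm, ENNReal.ofReal_pow (norm_nonneg _)]

/-- The skeleton's rev-2 `gradVortSq u s = (∫⁻ ofReal |∇ω|²_F).toReal` is the Bochner integral `∫ |∇ω|²_F`
for a smooth slice with `D²u(s) ∈ L²`. [folklore] -/
private theorem gradVortSq_eq_integral {u : ℝ → EuclideanSpace ℝ (Fin 3) → EuclideanSpace ℝ (Fin 3)} {s : ℝ}
    (hsm : ContDiff ℝ 3 (u s)) (h2 : ∫⁻ x, ‖iteratedFDeriv ℝ 2 (u s) x‖ₑ ^ 2 < ⊤) :
    Literature.Claims.NS.Permana2026.gradVortSq u s = ∫ x, frobeniusNormSq (fderiv ℝ (curl (u s)) x) := by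
  unfold Literature.Claims.NS.Permana2026.gradVortSq
  rw [integral_eq_lintegral_of_nonneg_ae (Eventually.of_forall fun x => frobeniusNormSq_nonneg _)
    (integrable_frobeniusNormSq_fderiv_curl hsm h2).1.aestronglyMeasurable]

/-- **Step 4 of C119 holds (rev 2)** — the enstrophy identity (20) p.5 l.59–68 in the class: along every
`Chae2007.IsLocalSolution` with `ν > 0` on `[0,T)`, `E(t) = ‖ω(t)‖²_{L²}` is continuous on `[0,T)` and has at
every `t ∈ [0,T)` the right derivative `−2ν‖∇ω(t)‖²_{L²} + 2∫⟪ω,(∇u)ω⟫` (Frobenius palinstrophy, as printed).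
Bridge: the class restricted to a closed slab `[0,T'']` (`isSolutionOn_of_isLocalSolution`, salvage-p4) and the
slab enstrophy evolution `Lindgren2012Salvage.lindgren2012_step3_holds` (salvage-p3; derivative
`2(stretchPerp + ν·dissip)` within `[0,T'']`), with `stretchPerp = ∫⟪ω,(∇u)ω⟫` (`integral_stretching_eq_stretch`)
and `dissip = −∫|∇ω|²_F` (`dissip_eq_neg_integral_frobeniusNormSq`).
[cite: Permana2026, (20) p.5 l.59–68] [cite: MajdaBertozziCUP2002, §3.1.1 p. 87–88] -/
theorem step_4_holds : Literature.Claims.NS.Permana2026.Step_4 := by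
  intro ν hν T hT v₀ u p hsol
  -- the slab computation at each `t ∈ [0,T)`, on `[0, (t+T)/2]`
  have key : ∀ t ∈ Ico 0 T, t < (t + T) / 2 ∧
      HasDerivWithinAt (Literature.Claims.NS.Permana2026.enstrophy u)
        (-(2 * ν * Literature.Claims.NS.Permana2026.gradVortSq u t) +
          2 * Literature.Claims.NS.Permana2026.stretch u t) (Icc 0 ((t + T) / 2)) t := by
    intro t ht
    have htT'' : t < (t + T) / 2 := by linarith [ht.2]
    have hT''T : (t + T) / 2 < T := by linarith [ht.2]
    have hT''0 : 0 < (t + T) / 2 := by linarith [ht.1]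
    have hsl := isSolutionOn_of_isLocalSolution hsol hT''0 hT''T
    have htI : t ∈ Icc 0 ((t + T) / 2) := ⟨ht.1, htT''.le⟩
    have hW := lindgren2012_step3_holds ν ((t + T) / 2) u p hν hT''0 hsl t htI
    have hS : IsClassicalNSSolutionOn (Icc 0 ((t + T) / 2)) ν 0 u p := hsl.isClassical
    have hB : HasBoundedSobolevNormsOn (Icc 0 ((t + T) / 2)) u := hsl.sobolev
    have hsm := hS.contDiff_velocity htI
    obtain ⟨B₀, hB₀⟩ := linfty_bound_of_hasBoundedSobolevNormsOn_holds
      (fun s hs => (hS.contDiff_velocity hs).of_le (by norm_cast)) hB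
    obtain ⟨B₁, -, hB₁⟩ := exists_forall_norm_fderiv_le_of_hasBoundedSobolevNormsOn
      (fun s hs => (hS.contDiff_velocity hs).of_le (by norm_cast)) hB
    have hfin : ∀ n : ℕ, ∫⁻ x, ‖iteratedFDeriv ℝ n (u t) x‖ₑ ^ 2 < ⊤ := fun n => by
      obtain ⟨C, hC⟩ := hB n
      exact (hC t htI).trans_lt ENNReal.coe_lt_top
    -- the two functions agree on the slab
    have hcongr : ∀ s ∈ Icc 0 ((t + T) / 2),
        Literature.Claims.NS.Permana2026.enstrophy u s = Literature.Claims.NS.Lindgren2012.enstrophy (u s) :=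
      fun s hs => enstrophy_eq_integral
        (contDiff_curl (n := 0) ((hS.contDiff_velocity hs).of_le (by norm_cast))).continuous
    -- the two derivative values agree
    have h1 : Lindgren2012.stretchPerp (u t) = Literature.Claims.NS.Permana2026.stretch u t := by
      rw [Lindgren2012.stretchPerp_eq, ← integral_stretching_eq_stretch hsm (hS.divFree t htI) (hB₀ t htI)
        (hB₁ t htI) (hfin 1) (hfin 2)]
      rfl
    have h2 : Lindgren2012.dissip (u t) = -Literature.Claims.NS.Permana2026.gradVortSq u t := by
      rw [dissip_eq_neg_integral_frobeniusNormSq hsm (hfin 1) (hfin 2) (hfin 3),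
        gradVortSq_eq_integral (hsm.of_le (by norm_cast)) (hfin 2)]
    refine ⟨htT'', ((hW.congr (fun s hs => hcongr s hs) (hcongr t htI)).congr_deriv ?_)⟩
    rw [h1, h2]; ring
  refine ⟨fun t ht => ?_, fun t ht => ?_⟩
  · -- continuity within `[0,T)` at `t`, from differentiability within the slab
    obtain ⟨hlt, hD⟩ := key t ht
    refine hD.continuousWithinAt.mono_of_mem_nhdsWithin (mem_nhdsWithin.2 ⟨Iio ((t + T) / 2), isOpen_Iio,
      hlt, fun s hs => ⟨hs.2.1, le_of_lt hs.1⟩⟩)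
  · -- the right derivative at `t`: `[0,(t+T)/2]` is a neighbourhood of `t` within `[t, ∞)`
    obtain ⟨hlt, hD⟩ := key t ht
    exact hD.mono_of_mem_nhdsWithin (mem_of_superset (Icc_mem_nhdsGE hlt) (Icc_subset_Icc_left ht.1))

end EnstrophyIdentity

end Summit.NavierStokesRegularity.NavierStokesRegularity.Theorems.Permana2026Salvage

end
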